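import Summits.CriticalPhenomena.CardyFormulaZ2.Theses.CardyBoundaryCoulombGas
import Summits.CriticalPhenomena.CardyFormulaZ2.Theorems.CardyBoundaryCoulombGasStripClusterRatesIterateAverage
import Literature.Probability.LatticeModels.RowStatePlanar

/-!
# Collatz–Wielandt step for the marked block (line `two-cluster-rate-is-stationary-gap`, crux `StripClusterRates`)

If the MARKED block of the planar `⋆`-chain `planarTransfer (Finset.Icc 0 n)` (patterns with some site joined to
`⋆`; entries `≥ 0`) has an eigenvector `v` that is strictly POSITIVE on marked patterns (and vanishes off the
block) with eigenvalue `λ > 0`, then `λ` IS the escape modulus of width `n`: `(λ, v)` is a marked eigenpair of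
modulus `λ`, and every complex marked eigenpair `(μ, u)` has `‖μ‖ ≤ λ` — compare `u` with `v` at a pattern
maximising `‖u p‖ / v p` (the elementary half of the Collatz–Wielandt formula; no irreducibility needed).
This is the glue by which the Bethe identification stub BI₁ of the line reduces to the existence of a positive
Bethe eigenvector (Yung–Batchelor 1995 algebraic Bethe ansatz + positivity), see the skeleton
`Cruxes/StripClusterRates/Lines/two_cluster_rate_is_stationary_gap.lean`. Tree vocabulary only, no definitions.
-/

noncomputable section

namespace Summit.CriticalPhenomena.CardyFormulaZ2.Cruxes.StripClusterRates.TwoClusterRateIsStationaryGap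

open scoped BigOperators Classical
open Literature.Probability.Percolation Literature.Probability.LatticeModels

/-- **Escape modulus from a positive eigenvector (Collatz–Wielandt).** A strictly positive eigenvector of the
marked block of `planarTransfer (Finset.Icc 0 n)` with eigenvalue `λ > 0` makes `λ` the escape modulus: it is
attained, and it dominates the modulus of every complex marked eigenpair. [folklore] -/
theorem bi1_escapeModulus_of_positiveVector :
    ∀ (n : ℕ) (lam : ℝ) (v : PlanarRowState (Finset.Icc (0 : ℤ) n) → ℝ), 0 < lam →
      (∀ p, (∃ x, p.1.JoinedToStar x) → 0 < v p) →
      (∀ p, (∀ x, ¬ p.1.JoinedToStar x) → v p = 0) →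
      (∀ p, (∃ x, p.1.JoinedToStar x) →
        ∑ q, planarTransfer (Finset.Icc (0 : ℤ) n) p q * v q = lam * v p) →
      ((∃ (μ : ℂ) (u : PlanarRowState (Finset.Icc (0 : ℤ) n) → ℂ),
          (u ≠ 0 ∧ (∀ p, (∀ x, ¬ p.1.JoinedToStar x) → u p = 0) ∧
            ∀ p, (∃ x, p.1.JoinedToStar x) →
              ∑ q, (planarTransfer (Finset.Icc (0 : ℤ) n) p q : ℂ) * u q = μ * u p) ∧
          ‖μ‖ = lam) ∧
        ∀ (μ : ℂ) (u : PlanarRowState (Finset.Icc (0 : ℤ) n) → ℂ),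
          (u ≠ 0 ∧ (∀ p, (∀ x, ¬ p.1.JoinedToStar x) → u p = 0) ∧
            ∀ p, (∃ x, p.1.JoinedToStar x) →
              ∑ q, (planarTransfer (Finset.Icc (0 : ℤ) n) p q : ℂ) * u q = μ * u p) →
          ‖μ‖ ≤ lam) := by
  intro n lam v hlam hpos hzero heig
  have hT0 : ∀ p q : PlanarRowState (Finset.Icc (0 : ℤ) n), 0 ≤ planarTransfer (Finset.Icc (0 : ℤ) n) p q :=
    fun p q => s1_planarTransfer_nonneg _ p q
  -- the wired state is marked
  have hwired : ∃ x, (PlanarRowState.wired (Finset.Icc (0 : ℤ) n)).1.JoinedToStar x :=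
    ⟨⟨0, by simp⟩, s1_joinedToStar_wired _⟩
  refine ⟨⟨(lam : ℂ), fun p => (v p : ℂ), ⟨?_, ?_, ?_⟩, ?_⟩, ?_⟩
  · -- `v ≠ 0` (it is positive at the wired state)
    intro h
    have h1 := congrFun h (PlanarRowState.wired (Finset.Icc (0 : ℤ) n))
    have h2 := hpos _ hwired
    simp only [Pi.zero_apply, Complex.ofReal_eq_zero] at h1
    exact h2.ne' h1
  · intro p hp
    simp only [hzero p hp, Complex.ofReal_zero]
  · intro p hp
    have h := heig p hp
    have e : ∑ q, (planarTransfer (Finset.Icc (0 : ℤ) n) p q : ℂ) * (v q : ℂ) =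
        ((∑ q, planarTransfer (Finset.Icc (0 : ℤ) n) p q * v q : ℝ) : ℂ) := by
      push_cast
      rfl
    rw [e, h]
    push_cast
    rfl
  · simp [abs_of_pos hlam]
  · -- domination of every complex marked eigenpair
    rintro μ u ⟨hu0, huz, hueig⟩
    -- a pattern where `u` does not vanish; it is marked
    obtain ⟨p₀, hp₀⟩ : ∃ p, u p ≠ 0 := by
      by_contra h
      push Not at h
      exact hu0 (funext h)
    have hp₀m : ∃ x, p₀.1.JoinedToStar x := by
      by_contra h
      push Not at h
      exact hp₀ (huz p₀ h)
    -- maximise the ratio `‖u p‖ / v p`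
    obtain ⟨pm, -, hpm⟩ := Finset.exists_max_image (Finset.univ : Finset (PlanarRowState (Finset.Icc (0 : ℤ) n)))
      (fun p => ‖u p‖ / v p) ⟨p₀, Finset.mem_univ _⟩
    have hc0 : 0 < ‖u pm‖ / v pm := by
      have h1 : 0 < ‖u p₀‖ / v p₀ := div_pos (norm_pos_iff.2 hp₀) (hpos p₀ hp₀m)
      exact h1.trans_le (hpm p₀ (Finset.mem_univ _))
    -- `pm` is marked and `u pm ≠ 0`
    have hvpm : 0 < v pm := by
      by_contra h
      have hle : v pm ≤ 0 := not_lt.1 h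
      have : ‖u pm‖ / v pm ≤ 0 := div_nonpos_of_nonneg_of_nonpos (norm_nonneg _) hle
      linarith
    have hpmm : ∃ x, pm.1.JoinedToStar x := by
      by_contra h
      push Not at h
      have := hzero pm h
      linarith
    have hupm : 0 < ‖u pm‖ := by
      have e : ‖u pm‖ = ‖u pm‖ / v pm * v pm := by rw [div_mul_cancel₀ _ hvpm.ne']
      rw [e]
      positivity
    -- termwise comparison `‖u q‖ ≤ c v q`, `c = ‖u pm‖ / v pm`
    have hcmp : ∀ q, ‖u q‖ ≤ ‖u pm‖ / v pm * v q := by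
      intro q
      by_cases hq : ∃ x, q.1.JoinedToStar x
      · exact (div_le_iff₀ (hpos q hq)).1 (hpm q (Finset.mem_univ _))
      · push Not at hq
        rw [huz q hq, hzero q hq, norm_zero, mul_zero]
    -- the Collatz–Wielandt estimate at `pm`
    have key : ‖μ‖ * ‖u pm‖ ≤ lam * ‖u pm‖ := by
      calc ‖μ‖ * ‖u pm‖ = ‖μ * u pm‖ := (norm_mul _ _).symm
        _ = ‖∑ q, (planarTransfer (Finset.Icc (0 : ℤ) n) pm q : ℂ) * u q‖ := by rw [hueig pm hpmm]
        _ ≤ ∑ q, ‖(planarTransfer (Finset.Icc (0 : ℤ) n) pm q : ℂ) * u q‖ := norm_sum_le _ _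
        _ = ∑ q, planarTransfer (Finset.Icc (0 : ℤ) n) pm q * ‖u q‖ := by
            refine Finset.sum_congr rfl fun q _ => ?_
            rw [norm_mul, Complex.norm_real, Real.norm_eq_abs, abs_of_nonneg (hT0 pm q)]
        _ ≤ ∑ q, planarTransfer (Finset.Icc (0 : ℤ) n) pm q * (‖u pm‖ / v pm * v q) :=
            Finset.sum_le_sum fun q _ => mul_le_mul_of_nonneg_left (hcmp q) (hT0 pm q)
        _ = ‖u pm‖ / v pm * ∑ q, planarTransfer (Finset.Icc (0 : ℤ) n) pm q * v q := by
            rw [Finset.mul_sum]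
            refine Finset.sum_congr rfl fun q _ => ?_
            ring
        _ = ‖u pm‖ / v pm * (lam * v pm) := by rw [heig pm hpmm]
        _ = lam * (‖u pm‖ / v pm * v pm) := by ring
        _ = lam * ‖u pm‖ := by rw [div_mul_cancel₀ _ hvpm.ne']
    exact le_of_mul_le_mul_right key hupm

end Summit.CriticalPhenomena.CardyFormulaZ2.Cruxes.StripClusterRates.TwoClusterRateIsStationaryGap

end
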